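import Mathlib
import HarnessLib
import Summits.HubbardSuperconductivity.HubbardSuperconductivity.Theorems.KLProgrammeKLRegimeEngineScaleZeroSymbol
import Summits.HubbardSuperconductivity.HubbardSuperconductivity.Theorems.KLProgrammeKLRegimeFrameShellCount

/-!
# K3 engine child (stmt-HubbardSuperconductivity-19855), stub `stub_engine_scale0`, clause (E1-v4)₀: the SUPPORT COUNT `N_s` of the
# padded scale-`0` multiplier symbol on `(ℤ/4M) × (ℤ/L)²`

Cell gate-hubbard-kl, seat hubbard-kl-k3c2-p1.  Continuation of `KLProgrammeKLRegimeEngineScaleZeroSymbol` (closed form of the padded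
symbol `G_ω(q) = G(ω̃_{q₁}² + e_K(q₂)²)·ζ̃_{0,ω}(θ(q₂))`, `G = bgmCutoffSq klE0`): the hypothesis `hsupp` of
`EngineV8.torusSum_le_of_symbol_bounds` (`#{q : G_ω(q) ≠ 0} ≤ N_s`), with `N_s` UNIFORM in the sector and of size `≍ (e₀β)(e₀L²)`:

* `card_le_floor_add_one_of_diam_lt` — a finite set of naturals of diameter `< X` has at most `⌊X⌋₊ + 1` elements;
* `card_freqWindow_le` — `#{q₁ ∈ ℤ/4M : |ω̃_{q₁}| < e₀} ≤ e₀β/π + 1` (the padded frequencies are spaced by `2π/β`);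
* `support_scaleZeroPadded_subset` — `{G_ω ≠ 0} ⊆ {|ω̃| < e₀} ×ˢ {|e_K| < e₀}` (where `G(u) ≠ 0` one has `u < e₀²`);
* **`card_support_scaleZeroPadded_le`** (`hsupp` with `N_s := #({|ω̃| < e₀} ×ˢ {|e_K| < e₀})`) and
  **`card_freqWindow_mul_shell_le_of_frameOK`**: `N_s ≤ (klE0·β/π + 1)·(1793·klE0·L² + 704·L)` for every admissible frame
  (k3c4-p1's `card_frameLevel_lt_le`).

Everything is proved; no definitions, no named facts, no sorry.
-/

noncomputable section

namespace Summit.HubbardSuperconductivity.HubbardSuperconductivity.Theorems.EngineV8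

set_option linter.dupNamespace false -- summit = problem name (single-conjunct summit), D-0017

open Real Finset Literature.MathematicalPhysics.QuantumLattice Literature.Probability.LatticeModels
open Literature.MathematicalPhysics.QuantumLattice.FermiRG
open Summit.HubbardSuperconductivity.HubbardSuperconductivity.Theorems.KLRegimeSplit
open Summit.HubbardSuperconductivity.HubbardSuperconductivity.Theorems.KLProgrammeLegKernels

variable {L M : ℕ}

/-! ## §1 Counting naturals in a short window -/

/-- **A finite set of naturals of diameter `< X` has at most `⌊X⌋₊ + 1` elements.** -/
theorem card_le_floor_add_one_of_diam_lt (S : Finset ℕ) {X : ℝ}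
    (hdiam : ∀ v ∈ S, ∀ w ∈ S, ((v : ℝ) - w) < X) : S.card ≤ ⌊X⌋₊ + 1 := by
  rcases S.eq_empty_or_nonempty with h | hne
  · simp [h]
  · set m := S.min' hne with hm
    have hsub : S ⊆ Finset.Icc m (m + ⌊X⌋₊) := by
      intro v hv
      rw [Finset.mem_Icc]
      refine ⟨S.min'_le v hv, ?_⟩
      have h1 : ((v : ℝ) - m) < X := hdiam v hv m (S.min'_mem hne)
      have h2 : m ≤ v := S.min'_le v hv
      have h3 : ((v - m : ℕ) : ℝ) < X := by push_cast [h2]; linarith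
      have h4 : v - m ≤ ⌊X⌋₊ := Nat.le_floor h3.le
      omega
    calc S.card ≤ (Finset.Icc m (m + ⌊X⌋₊)).card := Finset.card_le_card hsub
      _ = ⌊X⌋₊ + 1 := by rw [Nat.card_Icc]; omega

/-! ## §2 The frequency window `|ω̃| < e₀` -/

/-- **The number of padded frequencies below `e₀` in size**: `#{q₁ ∈ (ℤ/4M)¹ : |ω̃_{q₁}| < e₀} ≤ e₀β/π + 1`
(`ω̃_{q₁} = π(2 val q₁ - 2M + 1)/β`, spacing `2π/β`; `β > 0`, `e₀ ≥ 0`). -/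
theorem card_freqWindow_le [NeZero M] {β e₀ : ℝ} (hβ : 0 < β) (he : 0 ≤ e₀) :
    (((univ : Finset (TorusSite 1 (2 * (2 * M)))).filter fun q₁ => |gridFreq M (2 * (2 * M)) β q₁| < e₀).card : ℝ) ≤
      e₀ * β / Real.pi + 1 := by
  haveI : NeZero (2 * (2 * M)) := ⟨by have := NeZero.ne M; omega⟩
  set A := (univ : Finset (TorusSite 1 (2 * (2 * M)))).filter fun q₁ => |gridFreq M (2 * (2 * M)) β q₁| < e₀ with hA
  set f : TorusSite 1 (2 * (2 * M)) → ℕ := fun q₁ => (q₁ 0).val with hf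
  have hinj : Set.InjOn f A := by
    intro a _ b _ hab
    funext j
    rw [Subsingleton.elim j 0]
    exact ZMod.val_injective _ hab
  have hcard : A.card = (A.image f).card := (Finset.card_image_of_injOn hinj).symm
  -- the image has diameter `< e₀β/π`
  have hX : 0 ≤ e₀ * β / Real.pi := by positivity
  have hdiam : ∀ v ∈ A.image f, ∀ w ∈ A.image f, ((v : ℝ) - w) < e₀ * β / Real.pi := by
    intro v hv w hw
    obtain ⟨a, ha, rfl⟩ := Finset.mem_image.1 hv
    obtain ⟨b, hb, rfl⟩ := Finset.mem_image.1 hw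
    have ha' := (Finset.mem_filter.1 ha).2
    have hb' := (Finset.mem_filter.1 hb).2
    rw [gridFreq, abs_lt] at ha' hb'
    rw [hf]
    dsimp only
    have hπ := Real.pi_pos
    rw [lt_div_iff₀ hπ]
    have h1 := ha'.2
    have h2 := hb'.1
    rw [div_lt_iff₀ hβ] at h1
    rw [lt_div_iff₀ hβ] at h2
    nlinarith
  have h := card_le_floor_add_one_of_diam_lt (A.image f) hdiam
  rw [hcard]
  calc (((A.image f).card : ℕ) : ℝ) ≤ ((⌊e₀ * β / Real.pi⌋₊ + 1 : ℕ) : ℝ) := by exact_mod_cast h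
    _ = (⌊e₀ * β / Real.pi⌋₊ : ℝ) + 1 := by push_cast; ring
    _ ≤ e₀ * β / Real.pi + 1 := by linarith [Nat.floor_le hX]

/-! ## §3 The support of the padded symbol sits in (frequency window) × (band shell) -/

/-- **Support of the padded scale-`0` symbol**: for `klE0·β ≤ π(2M+1)`, `G_ω(q) ≠ 0` forces `|ω̃_{q₁}| < e₀` and `|e_K(q₂)| < e₀`
(`G(u) = 0` for `u ≥ e₀²`). -/
theorem support_scaleZeroPadded_subset [NeZero L] [NeZero M] {β : ℝ} (hβ : 0 < β) (hMβ : klE0 * β ≤ Real.pi * (2 * M + 1))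
    (μ : ℝ) (K : TrigPolyC4v) (ω : Fin (sectorCount 0)) :
    ((univ : Finset (TorusSite 1 (2 * (2 * M)) × TorusSite 2 L)).filter fun q =>
        (if h : (q.1 0).val < 2 * M then klAnisoFamily L M β μ K klE0 0 ω (⟨(q.1 0).val, h⟩, q.2) else 0) ≠ 0) ⊆
      ((univ : Finset (TorusSite 1 (2 * (2 * M)))).filter fun q₁ => |gridFreq M (2 * (2 * M)) β q₁| < klE0) ×ˢ
        ((univ : Finset (TorusSite 2 L)).filter fun k => |nambuXiCT L μ K k| < klE0) := by
  have he : (0 : ℝ) < klE0 := by norm_num [klE0]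
  intro q hq
  rw [Finset.mem_filter] at hq
  rw [Finset.mem_product, Finset.mem_filter, Finset.mem_filter]
  have hne := hq.2
  rw [scaleZeroPadded_eq hβ hMβ μ K ω q] at hne
  -- the cutoff factor is nonzero, so its argument is below `e₀²`
  have hG : bgmCutoffSq klE0 (gridFreq M (2 * (2 * M)) β q.1 ^ 2 + nambuXiCT L μ K q.2 ^ 2) ≠ 0 := by
    intro h0
    apply hne
    rw [h0, zero_mul, Complex.ofReal_zero]
  have hlt : gridFreq M (2 * (2 * M)) β q.1 ^ 2 + nambuXiCT L μ K q.2 ^ 2 < klE0 ^ 2 := by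
    by_contra hge
    exact hG (bgmCutoffSq_eq_zero_of_le he (le_of_not_gt hge))
  refine ⟨⟨mem_univ _, ?_⟩, ⟨mem_univ _, ?_⟩⟩
  · exact abs_lt_of_sq_lt_sq (by nlinarith [sq_nonneg (nambuXiCT L μ K q.2)]) he.le
  · exact abs_lt_of_sq_lt_sq (by nlinarith [sq_nonneg (gridFreq M (2 * (2 * M)) β q.1)]) he.le

/-- **`hsupp` with a sector-uniform `N_s`**: the support of every `G_ω` has at most `#({|ω̃| < e₀} ×ˢ {|e_K| < e₀})` points. -/
theorem card_support_scaleZeroPadded_le [NeZero L] [NeZero M] {β : ℝ} (hβ : 0 < β) (hMβ : klE0 * β ≤ Real.pi * (2 * M + 1))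
    (μ : ℝ) (K : TrigPolyC4v) (ω : Fin (sectorCount 0)) :
    ((univ : Finset (TorusSite 1 (2 * (2 * M)) × TorusSite 2 L)).filter fun q =>
        (if h : (q.1 0).val < 2 * M then klAnisoFamily L M β μ K klE0 0 ω (⟨(q.1 0).val, h⟩, q.2) else 0) ≠ 0).card ≤
      (((univ : Finset (TorusSite 1 (2 * (2 * M)))).filter fun q₁ => |gridFreq M (2 * (2 * M)) β q₁| < klE0) ×ˢ
        ((univ : Finset (TorusSite 2 L)).filter fun k => |nambuXiCT L μ K k| < klE0)).card :=
  Finset.card_le_card (support_scaleZeroPadded_subset hβ hMβ μ K ω)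

/-- **The size of `N_s` on an admissible frame**: `#({|ω̃| < e₀} ×ˢ {|e_K| < e₀}) ≤ (klE0·β/π + 1)·(1793·klE0·L² + 704·L)`
(frequency window × k3c4-p1's frame shell count `card_frameLevel_lt_le`). -/
theorem card_freqWindow_mul_shell_le_of_frameOK [NeZero L] [NeZero M] {R : RenConsts} {U : ℝ} {N : ℕ} {μ : ℝ} {K : TrigPolyC4v}
    (hK : FrameOK R U N μ K) {β : ℝ} (hβ : 0 < β) :
    ((((univ : Finset (TorusSite 1 (2 * (2 * M)))).filter fun q₁ => |gridFreq M (2 * (2 * M)) β q₁| < klE0) ×ˢ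
        ((univ : Finset (TorusSite 2 L)).filter fun k => |nambuXiCT L μ K k| < klE0)).card : ℝ) ≤
      (klE0 * β / Real.pi + 1) * (1793 * klE0 * (L : ℝ) ^ 2 + 704 * L) := by
  have he : (0 : ℝ) < klE0 := by norm_num [klE0]
  rw [Finset.card_product, Nat.cast_mul]
  refine mul_le_mul (card_freqWindow_le hβ he.le) (card_frameLevel_lt_le hK he (by norm_num [klE0])) (Nat.cast_nonneg _)
    (by positivity)

end Summit.HubbardSuperconductivity.HubbardSuperconductivity.Theorems.EngineV8

end
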